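import Summits.KontsevichZagierPeriods.KontsevichZagierPeriods.Theorems.RootDecompRationalCubeDichotomyMonomialDivisionP2

/-! lens-2 g10 MonomialDivision.lean @aa332d15, part 3/3: `section Wrap` — the local copy of `EtaleCubeBypass.MonomialDivisionAt` instantiated (`monomialDivisionAt`) and the iterated form `multiGenData_of_eq_prod_mul`. -/

noncomputable section

set_option linter.dupNamespace false
set_option linter.unusedVariables false
set_option linter.unusedSectionVars false

namespace Summit.KontsevichZagierPeriods.RootDecompRationalCubeDichotomy.Rung24903.MonomialDivision

open MvPolynomial Filter Topology
open Summit.KontsevichZagierPeriods.RootDecompRationalCubeDichotomy.Rung29430.MultiGen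
  (MultiGenData multiGenData_of_pointData ratBox isOpen_ratBox isSemialgebraic_ratBox exists_ratBox_subset)
open Summit.KontsevichZagierPeriods.RootDecompRationalCubeDichotomy.Rung29430.MultiGen.NashImplicit
  (solutions_eq_near)

section Wrap

/-- Local copy of `EtaleCubeBypass.MonomialDivisionAt` (§3 of the NODE's main file; byte-identical body),
so that the instantiation below is checked by the kernel (the HOME files are not modules of the tree). -/
def MonomialDivisionAt (n : ℕ) : Prop :=
  ∀ (k : ℕ) (g q : (Fin n → ℝ) → ℝ) (x₀ : Fin n → ℝ) (i : Fin n) (c : ℚ), x₀ i = (c : ℝ) →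
    MultiGenData n k g x₀ → AnalyticAt ℝ q x₀ → (∀ᶠ x in nhds x₀, g x = (x i - (c : ℝ)) * q x) →
    ∃ k', MultiGenData n k' q x₀

/-- **P4 holds in every dimension.** -/
theorem monomialDivisionAt (n : ℕ) : MonomialDivisionAt n := monomialDivisionAt_holds n

/-- the product of rational coordinate factors is analytic. [bookkeeping] -/
theorem analyticAt_listProd_coord {n : ℕ} (L : List (Fin n × ℚ)) (x₀ : Fin n → ℝ) :
    AnalyticAt ℝ (fun x : Fin n → ℝ => (L.map fun ic => x ic.1 - (ic.2 : ℝ)).prod) x₀ := by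
  induction L with
  | nil => simp only [List.map_nil, List.prod_nil]; exact analyticAt_const
  | cons jc L' ih' =>
    simp only [List.map_cons, List.prod_cons]
    exact (((ContinuousLinearMap.proj (R := ℝ) (φ := fun _ : Fin n => ℝ) jc.1).analyticAt x₀).sub
      analyticAt_const).mul ih'

/-- Iterated form used by DESCENT step (iv): division by a product of rational coordinate factors
`∏ (x_{i_l} - c_l)` (any multiplicity), one factor at a time. -/
theorem multiGenData_of_eq_prod_mul {n k : ℕ} {g q : (Fin n → ℝ) → ℝ} {x₀ : Fin n → ℝ}
    (L : List (Fin n × ℚ)) (hL : ∀ ic ∈ L, x₀ ic.1 = (ic.2 : ℝ))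
    (hg : MultiGenData n k g x₀) (hq : AnalyticAt ℝ q x₀)
    (hgq : ∀ᶠ x in nhds x₀, g x = (L.map fun ic => x ic.1 - (ic.2 : ℝ)).prod * q x) :
    ∃ k', MultiGenData n k' q x₀ := by
  induction L generalizing g k with
  | nil =>
    refine ⟨k, ?_⟩
    obtain ⟨V, u, F, A, B, hVo, hx₀V, husa, huan, hFu, hJ, hgAB⟩ := hg
    obtain ⟨W, hWsub, hWo, hx₀W⟩ := _root_.mem_nhds_iff.1 hgq
    -- shrink to a rational box (semialgebraic) inside `V ∩ W`
    obtain ⟨a, b, hx₀B, hBsub⟩ := exists_ratBox_subset (hVo.inter hWo) (x₀ := x₀) ⟨hx₀V, hx₀W⟩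
    have hBV : ratBox a b ⊆ V := fun x hx => (hBsub hx).1
    refine ⟨ratBox a b, u, F, A, B, isOpen_ratBox a b, hx₀B,
      fun j => (husa j).mono hBV (isSemialgebraic_ratBox a b), fun j => (huan j).mono hBV,
      fun x hx m => hFu x (hBV hx) m, hJ, fun x hx => ?_⟩
    refine ⟨(hgAB x (hBV hx)).1, ?_⟩
    have h := hWsub (hBsub hx).2
    simp only [List.map_nil, List.prod_nil, one_mul, Set.mem_setOf_eq] at h
    rw [← h]; exact (hgAB x (hBV hx)).2
  | cons ic L ih =>
    -- g = (x_{i} - c) * (rest * q): divide once, then recurse on `rest * q`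
    have hrest : AnalyticAt ℝ (fun x => (L.map fun ic => x ic.1 - (ic.2 : ℝ)).prod * q x) x₀ :=
      (analyticAt_listProd_coord L x₀).mul hq
    obtain ⟨k₁, hk₁⟩ := monomialDivisionAt_holds n k g
      (fun x => (L.map fun ic => x ic.1 - (ic.2 : ℝ)).prod * q x) x₀ ic.1 ic.2
      (hL ic (List.mem_cons_self)) hg hrest
      (hgq.mono fun x hx => by rw [hx, List.map_cons, List.prod_cons, mul_assoc])
    exact ih (fun jc hjc => hL jc (List.mem_cons_of_mem _ hjc)) hk₁
      (Filter.Eventually.of_forall fun x => rfl)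

/-! Axiom audit (farm `lean check --axioms`): `monomialDivisionAt`, `multiGenData_of_eq_prod_mul` —
{propext, Classical.choice, Quot.sound}. -/

end Wrap

end Summit.KontsevichZagierPeriods.RootDecompRationalCubeDichotomy.Rung24903.MonomialDivision

end
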